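import Summits.QuantumFields.YangMills.Theorems.ScalingWindowSplitSelfNormalisedSkewnessWitnessNoFlux
import Summits.QuantumFields.YangMills.Theorems.ScalingWindowSplitSelfNormalisedSkewnessWitnessU1Action
import HarnessLib

/-!
# `SelfNormalisedSkewness` — negative side: the small-field chart of `V = im d`

Route `ScalingWindowSplit`, crux `stmt-QuantumFields-18944`, line `Sketch` (negation branch), support for the
lead's `stub_witnessAssembly`.  For `U(1)` on `(ℤ/S)⁴`, with `ρ(U) = d(arg ∘ U) ∈ V` and the period lattice
`Γ = V ∩ 2πℤ^P`: for `F : V → ℝ≥0∞` vanishing off the open `ε`-box (`ε ≤ π`) the periodised sum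
`Σ_γ F(ρ(U) + γ)` equals `F(ω(U))` when all plaquette angles are `< ε` and `ω(U)` is exact, and `0` otherwise;
combined with the landed abelian pushforward (`stub_abelianPushforward`, hypothesis `hPush`) and no-flux
(`stub_torusTwoFormExact`, hypothesis `hExact`, via `plaqAngle_mem_range_of_small`) this gives the CHART IDENTITY
`∫ 1{∀p |ω_p| < ε} F(ω(U)) dHaar^E = c ∫_V F dvol` with a constant `c ∈ (0,∞)` depending on `S` only
(`exists_chart_constant`); `omegaV` is the measurable `V`-valued version of the plaquette-angle vector.

References: Lüscher 1999 §3; the pushforward is Weil's formula for `0 → ker d → U(1)^E → im → 0` made explicit.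
No definitions of propositions, no named facts.
-/

noncomputable section

open scoped BigOperators ENNReal
open MeasureTheory
open Literature.MathematicalPhysics.QuantumLattice Literature.MathematicalPhysics.QuantumFieldTheory
open Literature.Probability.LatticeModels (TorusSite torusGreen)

namespace Summit.QuantumFields.YangMills.Theorems.SelfNormalisedSkewness.Negative

variable {S : ℕ}

/-! ## The chart: periodised sums collapse to the plaquette-angle vector -/

section Chart

open scoped ENNReal
open MeasureTheory

variable [NeZero S]

/-- The link-argument coboundary `ρ(U) = d (arg ∘ U)` as an element of `V = im d`. [folklore] -/
def rhoV (U : GaugeConfig 4 S Circle) : LinearMap.range (plaqCoboundary S) :=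
  ⟨plaqCoboundary S (fun e => Complex.arg (U e : ℂ)), LinearMap.mem_range_self _ _⟩

omit [NeZero S] in
/-- `rhoV` unfolded. [folklore] -/
@[simp] theorem coe_rhoV (U : GaugeConfig 4 S Circle) :
    (rhoV U : EuclideanSpace ℝ (Plaquette 4 S)) = plaqCoboundary S (fun e => Complex.arg (U e : ℂ)) := rfl

/-- Two reals that differ by an integer multiple of `2π` and by less than `2π` are equal. [folklore] -/
theorem eq_of_sub_eq_int_mul_two_pi {a b : ℝ} {n : ℤ} (h : a - b = n * (2 * Real.pi))
    (hab : |a - b| < 2 * Real.pi) : a = b :=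
  sub_eq_zero.1 (eq_zero_of_intCast_mul_two_pi_of_abs_lt h hab)

/-- **One term survives on the good set.**  If `F : V → ℝ≥0∞` vanishes off the open `ε`-box, `ε ≤ π`, and the
plaquette-angle vector `ω(U)` is exact with all `|ω_p(U)| < ε`, then the `Γ`-periodised sum
`Σ_γ F(ρ(U) + γ)` equals `F(ω(U))`. [folklore] -/
theorem tsum_periodised_eq_of_good {ε : ℝ} (hεπ : ε ≤ Real.pi)
    (F : LinearMap.range (plaqCoboundary S) → ℝ≥0∞)
    (hF : ∀ v : LinearMap.range (plaqCoboundary S),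
      (∃ p, ε ≤ |(v : EuclideanSpace ℝ (Plaquette 4 S)) p|) → F v = 0)
    (U : GaugeConfig 4 S Circle) (hω : plaqAngle U ∈ LinearMap.range (plaqCoboundary S))
    (hU : ∀ p, |plaqAngle U p| < ε) :
    (∑' γ : {v : LinearMap.range (plaqCoboundary S) //
        ∀ p : Plaquette 4 S, ∃ m : ℤ, (v : EuclideanSpace ℝ (Plaquette 4 S)) p = 2 * Real.pi * m},
      F (rhoV U + (γ : LinearMap.range (plaqCoboundary S)))) = F ⟨plaqAngle U, hω⟩ := by
  obtain ⟨m, hm⟩ := exists_int_plaqCoboundary_arg_eq U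
  -- the surviving period
  have hγ₀ : ∀ p : Plaquette 4 S, ∃ k : ℤ,
      ((⟨plaqAngle U, hω⟩ - rhoV U : LinearMap.range (plaqCoboundary S)) :
        EuclideanSpace ℝ (Plaquette 4 S)) p = 2 * Real.pi * k := fun p =>
    ⟨-m p, by simp only [Submodule.coe_sub, coe_rhoV, PiLp.sub_apply, hm p]; push_cast; ring⟩
  set γ₀ : {v : LinearMap.range (plaqCoboundary S) //
      ∀ p : Plaquette 4 S, ∃ m : ℤ, (v : EuclideanSpace ℝ (Plaquette 4 S)) p = 2 * Real.pi * m} :=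
    ⟨⟨plaqAngle U, hω⟩ - rhoV U, hγ₀⟩ with hγ₀def
  have hsum : rhoV U + (γ₀ : LinearMap.range (plaqCoboundary S)) = ⟨plaqAngle U, hω⟩ := by
    simp [hγ₀def]
  rw [tsum_eq_single γ₀]
  · rw [hsum]
  · intro γ hne
    apply hF
    by_contra hcon
    push Not at hcon
    apply hne
    -- all coordinates of `ρ + γ` are `< ε`: then `γ = γ₀`
    apply Subtype.ext
    apply Subtype.ext
    ext p
    obtain ⟨a, ha⟩ := γ.2 p
    obtain ⟨b, hb⟩ := γ₀.2 p
    have h1 : ((rhoV U + (γ : LinearMap.range (plaqCoboundary S)) : LinearMap.range (plaqCoboundary S)) :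
        EuclideanSpace ℝ (Plaquette 4 S)) p = plaqCoboundary S (fun e => Complex.arg (U e : ℂ)) p + 2 * Real.pi * a := by
      simp [ha]
    have h2 : plaqCoboundary S (fun e => Complex.arg (U e : ℂ)) p + 2 * Real.pi * b = plaqAngle U p := by
      have := congrArg (fun v : LinearMap.range (plaqCoboundary S) => (v : EuclideanSpace ℝ (Plaquette 4 S)) p) hsum
      simpa [hb] using this
    have hlt := hcon p
    rw [h1] at hlt
    -- `(ρ+γ)_p` and `ω_p` differ by `2π(a-b)` and by `< 2ε ≤ 2π`
    have hdiff : (plaqCoboundary S (fun e => Complex.arg (U e : ℂ)) p + 2 * Real.pi * a) - plaqAngle U p =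
        (a - b : ℤ) * (2 * Real.pi) := by rw [← h2]; push_cast; ring
    have habs : |(plaqCoboundary S (fun e => Complex.arg (U e : ℂ)) p + 2 * Real.pi * a) - plaqAngle U p| <
        2 * Real.pi := by
      have := hU p
      calc _ ≤ |plaqCoboundary S (fun e => Complex.arg (U e : ℂ)) p + 2 * Real.pi * a| + |plaqAngle U p| :=
            abs_sub _ _
        _ < ε + ε := add_lt_add hlt this
        _ ≤ 2 * Real.pi := by linarith
    have heq := eq_of_sub_eq_int_mul_two_pi hdiff habs
    -- hence `a = b`
    have hab : (a : ℝ) = b := by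
      have h3 : 2 * Real.pi * a = 2 * Real.pi * b := by linarith [heq, h2]
      have hπ : (2 * Real.pi) ≠ 0 := by positivity
      exact mul_left_cancel₀ hπ h3
    rw [ha, hb, hab]

/-- **No term survives off the good set.**  If `F` vanishes off the open `ε`-box, `ε ≤ π`, and some plaquette
angle has `|ω_p(U)| ≥ ε`, then `Σ_γ F(ρ(U) + γ) = 0`. [folklore] -/
theorem tsum_periodised_eq_zero_of_bad {ε : ℝ} (hεπ : ε ≤ Real.pi)
    (F : LinearMap.range (plaqCoboundary S) → ℝ≥0∞)
    (hF : ∀ v : LinearMap.range (plaqCoboundary S),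
      (∃ p, ε ≤ |(v : EuclideanSpace ℝ (Plaquette 4 S)) p|) → F v = 0)
    (U : GaugeConfig 4 S Circle) (hU : ¬ ∀ p, |plaqAngle U p| < ε) :
    (∑' γ : {v : LinearMap.range (plaqCoboundary S) //
        ∀ p : Plaquette 4 S, ∃ m : ℤ, (v : EuclideanSpace ℝ (Plaquette 4 S)) p = 2 * Real.pi * m},
      F (rhoV U + (γ : LinearMap.range (plaqCoboundary S)))) = 0 := by
  obtain ⟨m, hm⟩ := exists_int_plaqCoboundary_arg_eq U
  refine ENNReal.tsum_eq_zero.2 fun γ => hF _ ?_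
  by_contra hcon
  push Not at hcon
  apply hU
  intro p
  obtain ⟨a, ha⟩ := γ.2 p
  have h1 : ((rhoV U + (γ : LinearMap.range (plaqCoboundary S)) : LinearMap.range (plaqCoboundary S)) :
      EuclideanSpace ℝ (Plaquette 4 S)) p = plaqAngle U p + (m p + a : ℤ) * (2 * Real.pi) := by
    simp only [Submodule.coe_add, coe_rhoV, PiLp.add_apply, hm p, ha]
    push_cast; ring
  have hlt := hcon p
  rw [h1] at hlt
  have habs : |(plaqAngle U p + (m p + a : ℤ) * (2 * Real.pi)) - plaqAngle U p| < 2 * Real.pi := by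
    have hlo := neg_pi_lt_abelianFieldTensor U p.1 p.2.1.1 p.2.1.2
    have hhi := abelianFieldTensor_le_pi U p.1 p.2.1.1 p.2.1.2
    rw [← plaqAngle_apply] at hlo hhi
    rw [abs_lt] at hlt ⊢
    constructor <;> linarith [hlt.1, hlt.2]
  have heq := eq_of_sub_eq_int_mul_two_pi (by ring) habs
  rw [heq] at hlt
  exact hlt


/-! ### The measurable plaquette-angle vector as an element of `V` -/

omit [NeZero S] in
/-- Each plaquette angle is measurable in the configuration. [folklore] -/
theorem measurable_abelianFieldTensor (x : Site 4 S) (i j : Fin 4) :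
    Measurable fun U : GaugeConfig 4 S Circle => abelianFieldTensor U x i j := by
  have hcc : Continuous fun z : Circle => (z : ℂ) := continuous_subtype_val
  have hc : Measurable fun z : Circle => Complex.arg (z : ℂ) := Complex.measurable_arg.comp hcc.measurable
  exact hc.comp (measurable_plaquetteHolonomy (G := Circle) x i j)

omit [NeZero S] in
/-- `plaqAngle` is measurable. [folklore] -/
theorem measurable_plaqAngle : Measurable (plaqAngle : GaugeConfig 4 S Circle → EuclideanSpace ℝ (Plaquette 4 S)) := by
  have h : Measurable fun U : GaugeConfig 4 S Circle => fun p : Plaquette 4 S =>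
      abelianFieldTensor U p.1 p.2.1.1 p.2.1.2 :=
    measurable_pi_iff.2 fun p => measurable_abelianFieldTensor p.1 p.2.1.1 p.2.1.2
  exact (MeasurableEquiv.toLp 2 (Plaquette 4 S → ℝ)).measurable.comp h

/-- The range of the coboundary is a measurable subset of `ℝ^{Plaquette 4 S}`. [folklore] -/
theorem measurableSet_range_plaqCoboundary :
    MeasurableSet ((LinearMap.range (plaqCoboundary S) : Submodule ℝ (EuclideanSpace ℝ (Plaquette 4 S))) :
      Set (EuclideanSpace ℝ (Plaquette 4 S))) :=
  (Submodule.closed_of_finiteDimensional _).measurableSet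

/-- **The plaquette-angle vector as an element of `V = im d`** (junk value `0` when it is not exact — off the
small-field region). [folklore] -/
def omegaV (U : GaugeConfig 4 S Circle) : LinearMap.range (plaqCoboundary S) :=
  open scoped Classical in
  if h : plaqAngle U ∈ LinearMap.range (plaqCoboundary S) then ⟨plaqAngle U, h⟩ else 0

omit [NeZero S] in
/-- `omegaV = ω` when `ω` is exact. [folklore] -/
theorem omegaV_of_mem {U : GaugeConfig 4 S Circle} (h : plaqAngle U ∈ LinearMap.range (plaqCoboundary S)) :
    omegaV U = ⟨plaqAngle U, h⟩ := by
  unfold omegaV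
  rw [dif_pos h]

omit [NeZero S] in
open scoped Classical in
/-- The underlying vector of `omegaV` is `ω` on the exact set and `0` elsewhere. [folklore] -/
theorem coe_omegaV_eq_piecewise :
    (fun U : GaugeConfig 4 S Circle => (omegaV U : EuclideanSpace ℝ (Plaquette 4 S))) =
      {U : GaugeConfig 4 S Circle | plaqAngle U ∈ LinearMap.range (plaqCoboundary S)}.piecewise plaqAngle 0 := by
  classical
  funext U
  by_cases h : plaqAngle U ∈ LinearMap.range (plaqCoboundary S)
  · rw [Set.piecewise_eq_of_mem {U : GaugeConfig 4 S Circle | plaqAngle U ∈ LinearMap.range (plaqCoboundary S)} _ _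
      (show U ∈ {U : GaugeConfig 4 S Circle | plaqAngle U ∈ LinearMap.range (plaqCoboundary S)} from h),
      omegaV_of_mem h]
  · rw [Set.piecewise_eq_of_notMem {U : GaugeConfig 4 S Circle | plaqAngle U ∈ LinearMap.range (plaqCoboundary S)} _ _
      (show U ∉ {U : GaugeConfig 4 S Circle | plaqAngle U ∈ LinearMap.range (plaqCoboundary S)} from h)]
    simp [omegaV, h]

/-- `omegaV` is measurable. [folklore] -/
theorem measurable_omegaV : Measurable (omegaV : GaugeConfig 4 S Circle → LinearMap.range (plaqCoboundary S)) := by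
  classical
  rw [← (MeasurableEmbedding.subtype_coe (measurableSet_range_plaqCoboundary (S := S))).measurable_comp_iff]
  change Measurable fun U : GaugeConfig 4 S Circle => (omegaV U : EuclideanSpace ℝ (Plaquette 4 S))
  rw [coe_omegaV_eq_piecewise]
  exact Measurable.piecewise (measurable_plaqAngle measurableSet_range_plaqCoboundary) measurable_plaqAngle
    measurable_const

/-- The small-field (good) set `{U : ∀ p, |ω_p(U)| < ε}` is measurable. [folklore] -/
theorem measurableSet_goodSet (ε : ℝ) :
    MeasurableSet {U : GaugeConfig 4 S Circle | ∀ p : Plaquette 4 S, |plaqAngle U p| < ε} := by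
  have : {U : GaugeConfig 4 S Circle | ∀ p : Plaquette 4 S, |plaqAngle U p| < ε} =
      ⋂ p : Plaquette 4 S, {U | |plaqAngle U p| < ε} := by ext U; simp
  rw [this]
  refine MeasurableSet.iInter fun p => measurableSet_lt ?_ measurable_const
  simp only [plaqAngle_apply]
  exact (measurable_abelianFieldTensor p.1 p.2.1.1 p.2.1.2).abs

/-- **The chart identity for product Haar.**  Assume the registered stubs `stub_abelianPushforward` (`hPush`) and
`stub_torusTwoFormExact` (`hExact`).  There is a constant `c ∈ (0, ∞)` (depending on `S` only) such that for every
`ε` with `0 < ε ≤ π`, `S⁴ε ≤ 2π`, `6ε ≤ 2π`, and every measurable `F : V → ℝ≥0∞` vanishing off the open `ε`-box,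
`∫ 1{∀p |ω_p(U)| < ε} F(ω(U)) dHaar^E(U) = c ∫_V F dvol`. [folklore] -/
theorem exists_chart_constant
    (hPush : ∀ {E P : Type} [Fintype E] [DecidableEq E] [Fintype P] [DecidableEq P]
      (n : P → E → ℤ) (d : (E → ℝ) →ₗ[ℝ] EuclideanSpace ℝ P),
      (∀ (θ : E → ℝ) (p : P), d θ p = ∑ e, (n p e : ℝ) * θ e) →
      ∃ c : ℝ≥0∞, c ≠ 0 ∧ c ≠ ∞ ∧
        ∀ F : LinearMap.range d → ℝ≥0∞, Measurable F →
          ∫⁻ U : E → Circle,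
              (∑' γ : {v : LinearMap.range d // ∀ p : P, ∃ m : ℤ, (v : EuclideanSpace ℝ P) p = 2 * Real.pi * m},
                F (⟨d (fun e => Complex.arg (U e : ℂ)), LinearMap.mem_range_self d _⟩ + (γ : LinearMap.range d)))
            ∂(Measure.pi fun _ : E => haarProbability Circle) =
          c * ∫⁻ v : LinearMap.range d, F v)
    (hExact : ∀ (S : ℕ) [NeZero S] (ω : Site 4 S → Fin 4 → Fin 4 → ℝ),
      LatticeForm.IsAlt ω → LatticeForm.td₂ ω = 0 → (∀ μ ν : Fin 4, ∑ x : Site 4 S, ω x μ ν = 0) →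
      ∃ θ : Site 4 S → Fin 4 → ℝ, LatticeForm.td₁ θ = ω) :
    ∃ c : ℝ≥0∞, c ≠ 0 ∧ c ≠ ∞ ∧ ∀ {ε : ℝ}, ε ≤ Real.pi → (S : ℝ) ^ 4 * ε ≤ 2 * Real.pi →
      6 * ε ≤ 2 * Real.pi → ∀ F : LinearMap.range (plaqCoboundary S) → ℝ≥0∞, Measurable F →
      (∀ v : LinearMap.range (plaqCoboundary S),
        (∃ p, ε ≤ |(v : EuclideanSpace ℝ (Plaquette 4 S)) p|) → F v = 0) →
      ∫⁻ U, {U : GaugeConfig 4 S Circle | ∀ p : Plaquette 4 S, |plaqAngle U p| < ε}.indicator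
          (fun U => F (omegaV U)) U ∂(Measure.pi fun _ : Edge 4 S => haarProbability Circle) =
        c * ∫⁻ v : LinearMap.range (plaqCoboundary S), F v := by
  classical
  obtain ⟨c, hc0, hctop, hc⟩ := hPush (plaqIncidence S) (plaqCoboundary S) (plaqCoboundary_eq_sum S)
  refine ⟨c, hc0, hctop, fun {ε} hεπ hSε h6 F hFm hF => ?_⟩
  rw [← hc F hFm]
  refine lintegral_congr fun U => ?_
  by_cases hU : ∀ p : Plaquette 4 S, |plaqAngle U p| < ε
  · have hω := plaqAngle_mem_range_of_small hExact hSε h6 U hU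
    rw [Set.indicator_of_mem (show U ∈ {U : GaugeConfig 4 S Circle | ∀ p, |plaqAngle U p| < ε} from hU),
      omegaV_of_mem hω]
    exact (tsum_periodised_eq_of_good hεπ F hF U hω hU).symm
  · rw [Set.indicator_of_notMem (show U ∉ {U : GaugeConfig 4 S Circle | ∀ p, |plaqAngle U p| < ε} from hU)]
    exact (tsum_periodised_eq_zero_of_bad hεπ F hF U hU).symm


/-! ### The chart identity for Wilson's measure -/

/-- On the whole configuration space Wilson's `U(1)` action is `Σ_p (1 − cos ω_p(U))` in terms of the plaquette-angle
vector. [folklore] -/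
theorem wilsonAction_u1_eq_sum_plaqAngle (U : GaugeConfig 4 S Circle) :
    wilsonAction u1Rep U = ∑ p : Plaquette 4 S, (1 - Real.cos (plaqAngle U p)) := by
  rw [wilsonAction_u1_eq_sum_one_sub_cos]
  rfl

/-- **The chart identity for Wilson's measure.**  Under `hPush` and `hExact` there is `c ∈ (0,∞)` (depending on
`S` only) such that for all admissible `ε` (`ε ≤ π`, `S⁴ε ≤ 2π`, `6ε ≤ 2π`), every `β` and every measurable
`F : V → ℝ≥0∞`:
`∫_{∀p |ω_p(U)| < ε} F(ω(U)) dμ_β(U) = Z_β⁻¹ · c · ∫_{V ∩ box_ε} F(v) e^{−β Σ_p (1 − cos v_p)} dvol(v)`. [folklore] -/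
theorem exists_chart_constant_wilson
    (hPush : ∀ {E P : Type} [Fintype E] [DecidableEq E] [Fintype P] [DecidableEq P]
      (n : P → E → ℤ) (d : (E → ℝ) →ₗ[ℝ] EuclideanSpace ℝ P),
      (∀ (θ : E → ℝ) (p : P), d θ p = ∑ e, (n p e : ℝ) * θ e) →
      ∃ c : ℝ≥0∞, c ≠ 0 ∧ c ≠ ∞ ∧
        ∀ F : LinearMap.range d → ℝ≥0∞, Measurable F →
          ∫⁻ U : E → Circle,
              (∑' γ : {v : LinearMap.range d // ∀ p : P, ∃ m : ℤ, (v : EuclideanSpace ℝ P) p = 2 * Real.pi * m},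
                F (⟨d (fun e => Complex.arg (U e : ℂ)), LinearMap.mem_range_self d _⟩ + (γ : LinearMap.range d)))
            ∂(Measure.pi fun _ : E => haarProbability Circle) =
          c * ∫⁻ v : LinearMap.range d, F v)
    (hExact : ∀ (S : ℕ) [NeZero S] (ω : Site 4 S → Fin 4 → Fin 4 → ℝ),
      LatticeForm.IsAlt ω → LatticeForm.td₂ ω = 0 → (∀ μ ν : Fin 4, ∑ x : Site 4 S, ω x μ ν = 0) →
      ∃ θ : Site 4 S → Fin 4 → ℝ, LatticeForm.td₁ θ = ω) :
    ∃ c : ℝ≥0∞, c ≠ 0 ∧ c ≠ ∞ ∧ ∀ {ε : ℝ}, ε ≤ Real.pi → (S : ℝ) ^ 4 * ε ≤ 2 * Real.pi →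
      6 * ε ≤ 2 * Real.pi → ∀ (β : ℝ) (F : LinearMap.range (plaqCoboundary S) → ℝ≥0∞), Measurable F →
      ∫⁻ U in {U : GaugeConfig 4 S Circle | ∀ p : Plaquette 4 S, |plaqAngle U p| < ε}, F (omegaV U)
          ∂(wilsonMeasure u1Rep β : Measure (GaugeConfig 4 S Circle)) =
        (partitionFunction (d := 4) (L := S) u1Rep β)⁻¹ * c *
          ∫⁻ v in {v : LinearMap.range (plaqCoboundary S) |
              ∀ p : Plaquette 4 S, |(v : EuclideanSpace ℝ (Plaquette 4 S)) p| < ε},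
            F v * ENNReal.ofReal (Real.exp (-(β * ∑ p : Plaquette 4 S,
              (1 - Real.cos ((v : EuclideanSpace ℝ (Plaquette 4 S)) p))))) := by
  classical
  obtain ⟨c, hc0, hctop, hc⟩ := exists_chart_constant (S := S) hPush hExact
  refine ⟨c, hc0, hctop, fun {ε} hεπ hSε h6 β F hFm => ?_⟩
  set G : Set (GaugeConfig 4 S Circle) := {U | ∀ p : Plaquette 4 S, |plaqAngle U p| < ε} with hG
  set B : Set (LinearMap.range (plaqCoboundary S)) :=
    {v | ∀ p : Plaquette 4 S, |(v : EuclideanSpace ℝ (Plaquette 4 S)) p| < ε} with hB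
  have hGm : MeasurableSet G := measurableSet_goodSet (S := S) ε
  have hBm : MeasurableSet B := by
    have : B = ⋂ p : Plaquette 4 S, {v : LinearMap.range (plaqCoboundary S) |
        |(v : EuclideanSpace ℝ (Plaquette 4 S)) p| < ε} := by ext v; simp [hB]
    rw [this]
    refine MeasurableSet.iInter fun p => measurableSet_lt ?_ measurable_const
    exact ((measurable_pi_apply p).comp ((MeasurableEquiv.toLp 2 (Plaquette 4 S → ℝ)).symm.measurable.comp
      measurable_subtype_coe)).abs
  -- the weight as a function on `V`
  set w : LinearMap.range (plaqCoboundary S) → ℝ≥0∞ := fun v => ENNReal.ofReal (Real.exp (-(β *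
    ∑ p : Plaquette 4 S, (1 - Real.cos ((v : EuclideanSpace ℝ (Plaquette 4 S)) p))))) with hw
  have hwm : Measurable w := by
    refine ENNReal.measurable_ofReal.comp (Real.measurable_exp.comp ?_)
    refine (Finset.measurable_sum _ fun p _ => ?_).const_mul _ |>.neg
    exact measurable_const.sub (Real.measurable_cos.comp ((measurable_pi_apply p).comp
      ((MeasurableEquiv.toLp 2 (Plaquette 4 S → ℝ)).symm.measurable.comp measurable_subtype_coe)))
  set F' : LinearMap.range (plaqCoboundary S) → ℝ≥0∞ := fun v => B.indicator (fun v => F v * w v) v with hF'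
  have hF'm : Measurable F' := (hFm.mul hwm).indicator hBm
  have hF'supp : ∀ v : LinearMap.range (plaqCoboundary S),
      (∃ p, ε ≤ |(v : EuclideanSpace ℝ (Plaquette 4 S)) p|) → F' v = 0 := by
    rintro v ⟨p, hp⟩
    simp only [hF']
    rw [Set.indicator_of_notMem]
    simp only [hB, Set.mem_setOf_eq, not_forall, not_lt]
    exact ⟨p, hp⟩
  have key := hc hεπ hSε h6 F' hF'm hF'supp
  -- left side: unfold Wilson's measure
  have hL : ∫⁻ U in G, F (omegaV U) ∂(wilsonMeasure u1Rep β : Measure (GaugeConfig 4 S Circle)) =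
      (partitionFunction (d := 4) (L := S) u1Rep β)⁻¹ *
        ∫⁻ U, G.indicator (fun U => F' (omegaV U)) U ∂(Measure.pi fun _ : Edge 4 S => haarProbability Circle) := by
    simp only [wilsonMeasure, wilsonWeight, Measure.restrict_smul, lintegral_smul_measure, smul_eq_mul]
    congr 1
    rw [← lintegral_indicator hGm,
      lintegral_withDensity_eq_lintegral_mul _ (by
        exact ENNReal.measurable_ofReal.comp (Real.measurable_exp.comp
          ((measurable_wilsonAction u1Rep continuous_u1Rep).const_mul _)))
        (show Measurable (G.indicator fun U => F (omegaV U)) from (hFm.comp measurable_omegaV).indicator hGm)]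
    refine lintegral_congr fun U => ?_
    by_cases hU : U ∈ G
    · simp only [Pi.mul_apply, Set.indicator_of_mem hU, hF']
      have hω := plaqAngle_mem_range_of_small hExact hSε h6 U hU
      have hin : omegaV U ∈ B := by
        rw [omegaV_of_mem hω]; exact hU
      rw [Set.indicator_of_mem hin, mul_comm]
      congr 1
      simp only [hw, wilsonAction_u1_eq_sum_plaqAngle, omegaV_of_mem hω, neg_mul]
    · simp only [Pi.mul_apply, Set.indicator_of_notMem hU, mul_zero]
  rw [hL, key, mul_assoc]
  congr 1
  congr 1
  rw [← lintegral_indicator hBm]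

end Chart
end Summit.QuantumFields.YangMills.Theorems.SelfNormalisedSkewness.Negative

end
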